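import Mathlib
import Summits.QuantumFields.YangMills.Theses.SmallFieldWidening
import Summits.QuantumFields.YangMills.Theorems.SmallFieldWideningLargeFieldMassRefinementTailOfStepOnlyFrom

/-! BC3 skeleton v10 CANDIDATE (width seat ym-line-sfw-p2-w2 gen 47, 2026-08-30T06:30Z; NOT registered — the lead owns the registry) for crux r3
`LargeFieldMassRefinementTail` of route SmallFieldWidening (stmt-QuantumFields-22884), line `birth`.

DELTA vs v9 (lead g33, registered, sha 174570fc): v9's one stub `stub_localStepFloor` = (base) ∧ (slack) ∧ (card) ∧ (step) with a base rate `c_b`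
fixed before the precision `η` and a starting run `k₀` chosen after it.  The (base) conjunct — the volume-uniform tail of the `k₀`-fold
(0.4)-averaged unit plaquette at run `k₀` — is PROVED in the tree for every FIXED `k₀` (`HistoryTailBoundedHeightLocal.perPlaquette_boundedHeight_uniform`,
cell ym3-torus; read at `K = j = k₀` with the profile's linearity in `b₀` by `LargeFieldMassRefinementTailStepOnlyFrom.baseClause_at`, p763760;
the `k₀ = 1` case independently by `LargeFieldMassRefinementTailBaseTail.baseClause_firstRun`, p763635).  v10 therefore registers the SMALLER stub
`stub_stepOnlyFrom` = (slack) ∧ (card) ∧ (step) from a starting run `k₀` fixed with `L, b₀, p₀` (before `η`), the letters `c_b, C_b, N_b` gone;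
the composition is the landed one-line closer `largeFieldMassRefinementTail_of_stepOnlyFrom` (⇒ `LocalStepFloor` ⇒ `PlainStabAdd` ⇒ r3 BY NAME).
The only freedom lost w.r.t. v9 is letting `k₀` grow with `η` (v9's «precision-dependent starting run»); a supplier who needs that keeps v9.

THE ONE STUB `stub_stepOnlyFrom` (XL — UNCHANGED OPEN CONTENT: the cutoff-uniform, EVENT-level, one-sided one-step small-field RG comparison of the
unit-plaquette tail restricted to the supplier's local finest-small-field guard; [Balaban1985UV3] (70)–(71) p.273, [Balaban1987RG1] Thm 1 p.259,
[Balaban1989LargeFieldII] §1 print DENSITY comparisons, not event probabilities — class open-in-print, see Lines/birth_dead.md §§1–32).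
No summit is proved by this line (rung R3 RECORD label; the YM mass gap is NOT proved by any of this). -/

noncomputable section

namespace Summit.QuantumFields.YangMills.Cruxes.LargeFieldMassRefinementTail.BirthV10

open MeasureTheory Filter Topology
open scoped BigOperators
open Literature.MathematicalPhysics.QuantumFieldTheory
open Literature.MathematicalPhysics.QuantumFieldTheory.Balaban1983to89
open Literature.MathematicalPhysics.QuantumFieldTheory.Balaban1983to89.Missing
open Literature.MathematicalPhysics.QuantumFieldTheory.Balaban1983to89.T3ContinuumYM3Torus
open Literature.MathematicalPhysics.QuantumFieldTheory.Balaban1983to89.T3UnitScaleTilt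
open Literature.MathematicalPhysics.QuantumFieldTheory.Balaban1983to89.T3UnitLawDensityEML (ℰp)
open Literature.MathematicalPhysics.QuantumFieldTheory.Balaban1983to89.T3LevelShift
open Summit.QuantumFields.YangMills.Theorems
open Summit.QuantumFields.YangMills.Theorems.LargeFieldMassRefinementTailStepOnlyFrom (largeFieldMassRefinementTail_of_stepOnlyFrom)

/-- THE ONE STUB `stub_stepOnlyFrom` (XL): a starting run `k₀ ≥ 1` and a guard profile `b' > 0` fixed with `L, b₀, p₀`; then for every precision
`η > 0` a locality exponent `M`, a coupling window `γ₁ ∈ (0,1]` and `A` with: for every family `F` (`F.L = L`, ANY volume), every `0 < γ ≤ γ₁` and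
every unit plaquette label `q`, one-step slacks `ρ_K`, threshold multipliers `t_K ∈ [1/2,1]` and finest-plaquette sets `S_K` of run `K+1` such that
(slack) every interval sum `Σ_{k≤j<K} ρ_j ≤ A + η·p(√γ)²` (`k ≥ k₀`), (card) `|S_K| ≤ (L^{K+1})^M` (`K ≥ k₀`), and (step)
`Gibbs_{K+1}({t_{K+1}θ(0) ≤ |Ū^{K+1}(∂q) − 1|} ∩ {every p ∈ S_K is θ_{b'}(K+1)-small}) ≤ e^{ρ_K}·Gibbs_K{t_Kθ(0) ≤ |Ū^K(∂q) − 1|}` (`K ≥ k₀`).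
Verbatim the hypothesis of `LargeFieldMassRefinementTailStepOnlyFrom.largeFieldMassRefinementTail_of_stepOnlyFrom`.
[cite: Balaban1985UV3, (70)-(71) p.273; Balaban1987RG1, Thm 1 p.259; Balaban1989LargeFieldII, §1 pp.355-356] -/
theorem stub_stepOnlyFrom :
    ∀ (L : ℕ) (b₀ p₀ : ℝ), 0 < b₀ → 2 < p₀ → ∃ (k₀ : ℕ) (b' : ℝ), 1 ≤ k₀ ∧ 0 < b' ∧ ∀ η : ℝ, 0 < η →
      ∃ (M : ℕ) (γ₁ A : ℝ), 0 < γ₁ ∧ γ₁ ≤ 1 ∧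
      ∀ (F : T3Family) (γ : ℝ), F.L = L → 0 < γ → γ ≤ γ₁ →
        ∀ q : Plaq (F.P 0) 0, ∃ (ρ t : ℕ → ℝ) (S : (K : ℕ) → Finset (Plaq (F.P (K + 1)) 0)),
          (∀ K : ℕ, 1 / 2 ≤ t K ∧ t K ≤ 1) ∧
          (∀ k K : ℕ, k₀ ≤ k → ∑ j ∈ Finset.Ico k K, ρ j ≤ A + η * B10.pFun b₀ p₀ (Real.sqrt γ) ^ 2) ∧
          (∀ K : ℕ, k₀ ≤ K → ((S K).card : ℝ) ≤ ((F.L : ℝ) ^ (K + 1)) ^ M) ∧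
          ∀ K : ℕ, k₀ ≤ K →
            (gibbsK F ℰp γ (K + 1)).real ({U | t (K + 1) * θBal F.L γ b₀ p₀ 0 ≤ GaugeGroup.dist1 (GaugeField.plaqHol
                (Averaging.iter (fun i => BlockAveraging.blockAvg (P := F.P (K + 1)) (j := i) ℰp) (K + 1) U)
                (plaqShift (F.sitesPerDir_unit (K + 1)) q))} ∩
              {U | PlaqSmallOn (↑(S K) : Set (Plaq (F.P (K + 1)) 0)) (θBal F.L γ b' p₀ (K + 1)) U}) ≤
            Real.exp (ρ K) *
            (gibbsK F ℰp γ K).real {U | t K * θBal F.L γ b₀ p₀ 0 ≤ GaugeGroup.dist1 (GaugeField.plaqHol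
                (Averaging.iter (fun i => BlockAveraging.blockAvg (P := F.P K) (j := i) ℰp) K U)
                (plaqShift (F.sitesPerDir_unit K) q))} := by
  sorry

/-- The crux modulo the ONE stub: r3 `LargeFieldMassRefinementTail` BY NAME (`StepOnlyFrom` → `LocalStepFloor` → `PlainStabAdd` → r3, all glues landed). -/
theorem LargeFieldMassRefinementTail_holds_of_stubs :
    Summit.QuantumFields.YangMills.Theses.SmallFieldWidening.LargeFieldMassRefinementTail :=
  largeFieldMassRefinementTail_of_stepOnlyFrom stub_stepOnlyFrom

end Summit.QuantumFields.YangMills.Cruxes.LargeFieldMassRefinementTail.BirthV10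

end
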